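import Summits.BirchSwinnertonDyer.Rank1Residual.F1Sign2.KuriharaLevelVanishingAtTwo
import Literature.NumberTheory.EllipticCurves.MazurRubin2010.TwistSelmerRankControl
import Literature.NumberTheory.EllipticCurves.BSDRootNumberSmallConductorProofs
import Literature.NumberTheory.EllipticCurves.KuriharaNumberParityProofs
import Literature.NumberTheory.EllipticCurves.PAdicLFunctionIntegralityAtTwoProofs
import HarnessLib

/-!
# K2-V is a theorem: (H) outright, (R) signed at the conductor level, level vanishing at two
(cell bsd-f1-sign2, seat -es; MEMO-es §11.0)

`heckeSumAtPrimeLevel_holds : HeckeSumAtPrimeLevel` (tree: `intCast_mul_ratPlusSymbol` = MTT (4.2) at `r = 0`,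
`cuspCoeff_eq_frobeniusTrace_of_isNewformOf_holds`, `not_dvd_level_of_isNewformOf`);
`frickeReflectionSigned_conductorLevel : [(N̄u)⁻¹/ℓ]⁺_f = w(E)·[u/ℓ]⁺_f` for the newform at level `N_W`
(tree: `IsNewformOf.isFrickeEigen_neg_rootNumber`, `IsFrickeEigen.normalizedPlusSymbol_div_eq_mul`,
`ratPlusSymbol_eq_mul_of_normalizedPlusSymbol_eq`, `ratPlusSymbol_neg`); hence
`levelVanishingAtTwo_conductorLevel` (UNCONDITIONAL) and
`levelVanishingAtTwo_of_exists_isNewformOf : exists_isNewformOf → LevelVanishingAtTwo` (modularity pins the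
level, `IsNewformOf.level_eq_level`).  Census DES6-v1 / DES9-v1: reflection resp. anti-reflection symmetry on
3 958/3 958 resp. 13 541/13 541 prime rows.

TYPER FILING (seat `bsd-f1-sign2-ty`, -es landing kit part 3/4, INBOX 2026-08-27T18:53:21Z): `HOME/data-es/landing/KuriharaLevelVanishingAtTwoProofs.lean`
sha16 0aa199905b9bbe91 (generated by `split.py` from `SketchG6.lean` d35efc04968d755c; joint farm check `Joint.lean` d1eaf26b918c249a rc 0, 0 warnings,
0 sorries, standard axioms), re-filed VERBATIM. REF1-AUDIT §19 verdicts (prop33_tau_ratR FAITHFUL-ASSEMBLY = §14 C′; K2-F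
`FirstLayerLawAtTwo` SURVIVES crux-grade OPEN; K2-F_an support) TRANSFER to this kit decl-for-decl (REF1 g3 INBOX 19:02:06Z, 31/31
bodies equal); K2-V/K2-P: REF1 §14 (G3 text; the G6 `LevelVanishingAtTwo` is the finer (W, ℓ, k, ψ) text whose conductor-level
case is PROVED unconditionally in part 3). REF2 v8/v9: K2-V IN-PRINT-ASSEMBLY support, K2-F OPEN-IN-PRINT (Kim 2022 p ≥ 5
template; beyond-print if proved: YES). Nothing asserted beyond the kernel-checked theorems; no named fact; PARTITION: none moved. -/

set_option autoImplicit false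

noncomputable section

open scoped Classical MatrixGroups ModularForm

open CongruenceSubgroup WeierstrassCurve Literature.NumberTheory.EllipticCurves
  Literature.NumberTheory.EllipticCurves.ModularForms NumberField

namespace Summit.BirchSwinnertonDyer.Rank1Residual.F1Sign2

/-! ## (H) and (R) from tree theorems; K2-V modulo modularity, unconditional at the conductor level -/

section Discharge

open Finset

/-- Reindexing `Fin n → ℤ/n` through `ZMod.val`. -/
private theorem sum_fin_eq_sum_zmod_val {n : ℕ} [NeZero n] {M : Type*} [AddCommMonoid M] (g : ℕ → M) :
    ∑ j : Fin n, g (j : ℕ) = ∑ x : ZMod n, g x.val := by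
  refine Fintype.sum_bijective (fun j : Fin n => ((j : ℕ) : ZMod n)) ⟨?_, ?_⟩ _ _ (fun j => ?_)
  · intro i j h
    have h' := congrArg ZMod.val h
    simp only [ZMod.val_cast_of_lt i.isLt, ZMod.val_cast_of_lt j.isLt] at h'
    exact Fin.ext h'
  · intro x
    exact ⟨⟨x.val, ZMod.val_lt x⟩, by simp only [ZMod.natCast_zmod_val]⟩
  · simp only [ZMod.val_cast_of_lt j.isLt]

/-- Over a prime field a sum over `ℤ/ℓ` is the value at `0` plus the sum over the units. -/
private theorem sum_univ_zmod_eq_add_sum_units {ℓ : ℕ} [Fact ℓ.Prime] {M : Type*} [AddCommMonoid M]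
    (G : ZMod ℓ → M) : ∑ x : ZMod ℓ, G x = G 0 + ∑ w : (ZMod ℓ)ˣ, G w := by
  have h1 : ∑ w : (ZMod ℓ)ˣ, G w = ∑ x : {x : ZMod ℓ // x ≠ 0}, G x :=
    Fintype.sum_equiv (unitsEquivNeZero (G₀ := ZMod ℓ)) (fun w : (ZMod ℓ)ˣ => G (w : ZMod ℓ))
      (fun x : {x : ZMod ℓ // x ≠ 0} => G (x : ZMod ℓ)) (fun w => rfl)
  have h2 : ∑ x : {x : ZMod ℓ // x ≠ 0}, G x = ∑ x ∈ (Finset.univ : Finset (ZMod ℓ)).erase 0, G x :=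
    (Finset.sum_subtype ((Finset.univ : Finset (ZMod ℓ)).erase 0) (p := fun x => x ≠ 0)
      (by intro x; simp [Finset.mem_erase]) G).symm
  rw [h1, h2, Finset.add_sum_erase _ _ (Finset.mem_univ (0 : ZMod ℓ))]

/-- **(H) is a theorem.**  `∑_{u ∈ (ℤ/ℓ)ˣ} [u/ℓ]⁺_f = (a_ℓ(W) − 2)[0]⁺_f` for the newform `f` of `W` (any
level) and a prime `ℓ ∤ N_W`: Mazur–Tate–Teitelbaum 1986 (4.2) at `r = 0` (tree `intCast_mul_ratPlusSymbol`)
with `a_ℓ(f) = a_ℓ(W)` (`cuspCoeff_eq_frobeniusTrace_of_isNewformOf_holds`). UNCONDITIONAL. -/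
theorem heckeSumAtPrimeLevel_holds : HeckeSumAtPrimeLevel := by
  intro W _ _ M _ f hf ℓ _ hN
  have hℓ : ℓ.Prime := Fact.out
  haveI : NeZero ℓ := ⟨hℓ.ne_zero⟩
  have hndvd : ¬ ℓ ∣ W.conductorNorm ℤ := (Nat.Prime.coprime_iff_not_dvd hℓ).mp hN.symm
  have hgood : W.HasGoodReductionAtPrime ℓ := by
    by_contra hbad
    exact hndvd ((W.dvd_conductorNorm_iff_not_hasGoodReductionAtPrime ℓ).mpr hbad)
  have hℓM : ¬ ℓ ∣ M := not_dvd_level_of_isNewformOf hf hgood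
  have hap : cuspCoeff f ℓ = ((W.frobeniusTrace ℓ : ℤ) : ℂ) :=
    cuspCoeff_eq_frobeniusTrace_of_isNewformOf_holds hf hgood
  have hH0 := intCast_mul_ratPlusSymbol ℓ hf.1 hℓ hℓM hap
    (ratCast_ratPlusSymbol_holds hf.1 hf.coeffField_eq_bot) 0
  simp only [zero_add, mul_zero] at hH0
  have h1 : ∑ j : Fin ℓ, ratPlusSymbol f (((j : ℕ) : ℚ) / ℓ)
      = ∑ x : ZMod ℓ, ratPlusSymbol f ((x.val : ℚ) / ℓ) :=
    sum_fin_eq_sum_zmod_val (fun i : ℕ => ratPlusSymbol f ((i : ℚ) / ℓ))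
  have h2 : ∑ x : ZMod ℓ, ratPlusSymbol f ((x.val : ℚ) / ℓ)
      = ratPlusSymbol f ((((0 : ZMod ℓ).val : ℚ)) / ℓ)
        + ∑ w : (ZMod ℓ)ˣ, ratPlusSymbol f ((((w : ZMod ℓ).val : ℚ)) / ℓ) :=
    sum_univ_zmod_eq_add_sum_units (fun x : ZMod ℓ => ratPlusSymbol f ((x.val : ℚ) / ℓ))
  rw [ZMod.val_zero, Nat.cast_zero, zero_div] at h2
  rw [h1, h2] at hH0
  linear_combination -hH0

/-- `w(E)² = 1`. -/
private theorem rootNumber_sq' (W : WeierstrassCurve ℚ) [W.IsElliptic] : W.rootNumber ^ 2 = 1 := by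
  rcases W.rootNumber_eq_one_or with h | h <;> rw [h] <;> norm_num

/-- **(R), signed, at the conductor level — a theorem.**  For the newform `f` of `W` at level `N_W`, a
prime `ℓ ∤ N_W` and `u ∈ (ℤ/ℓ)ˣ`: `[(N̄u)⁻¹/ℓ]⁺_f = w(E)·[u/ℓ]⁺_f` (Atkin–Lehner: `f|w_N = −w(E) f`,
tree `IsNewformOf.isFrickeEigen_neg_rootNumber`; Manin/MTT reflection
`IsFrickeEigen.normalizedPlusSymbol_div_eq_mul` with `a ℓ − u·N·v = 1`, `v ≡ −(N u)⁻¹`; evenness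
`ratPlusSymbol_neg`). UNCONDITIONAL. -/
theorem frickeReflectionSigned_conductorLevel (W : WeierstrassCurve ℚ) [W.IsElliptic] [W.IsGloballyMinimal]
    [NeZero (W.conductorNorm ℤ)] {f : CuspForm (Gamma0 (W.conductorNorm ℤ)) 2} (hf : IsNewformOf W f)
    (ℓ : ℕ) [Fact ℓ.Prime] (hN : Nat.Coprime (W.conductorNorm ℤ) ℓ) (u : (ZMod ℓ)ˣ) :
    ratPlusSymbol f (((((ZMod.unitOfCoprime (W.conductorNorm ℤ) hN * u)⁻¹ : (ZMod ℓ)ˣ) : ZMod ℓ).val : ℚ) / ℓ)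
      = (W.rootNumber : ℚ) * ratPlusSymbol f ((((u : ZMod ℓ).val : ℚ)) / ℓ) := by
  have hℓ : ℓ.Prime := Fact.out
  haveI : NeZero ℓ := ⟨hℓ.ne_zero⟩
  set Nbar : (ZMod ℓ)ˣ := ZMod.unitOfCoprime (W.conductorNorm ℤ) hN with hNbar
  set V : (ZMod ℓ)ˣ := (Nbar * u)⁻¹ with hV
  have hW := hf.isFrickeEigen_neg_rootNumber
  have hσ : W.rootNumber ^ 2 = 1 := rootNumber_sq' W
  have hprod : ((u : ZMod ℓ)) * ((W.conductorNorm ℤ : ℕ) : ZMod ℓ) * (V : ZMod ℓ) = 1 := by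
    have h' : (((Nbar * u) * V : (ZMod ℓ)ˣ) : ZMod ℓ) = 1 := by
      rw [hV, mul_inv_cancel, Units.val_one]
    rw [Units.val_mul, Units.val_mul, hNbar, ZMod.coe_unitOfCoprime] at h'
    linear_combination h'
  have hdvd : (ℓ : ℤ) ∣ (((u : ZMod ℓ).val : ℤ)) * (W.conductorNorm ℤ : ℤ) * (((V : ZMod ℓ).val : ℤ)) - 1 := by
    refine (ZMod.intCast_zmod_eq_zero_iff_dvd _ ℓ).mp ?_
    push_cast
    rw [ZMod.natCast_zmod_val, ZMod.natCast_zmod_val, hprod, sub_self]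
  obtain ⟨t, ht⟩ := hdvd
  have huv : (-t) * (ℓ : ℤ) - (((u : ZMod ℓ).val : ℤ)) * ((W.conductorNorm ℤ : ℤ) * (-(((V : ZMod ℓ).val : ℤ)))) = 1 := by
    linear_combination ht
  have hsym := hW.normalizedPlusSymbol_div_eq_mul hσ hℓ.pos huv
  have hrat := ratPlusSymbol_eq_mul_of_normalizedPlusSymbol_eq f hσ hsym
  have hneg : ratPlusSymbol f ((((-(((V : ZMod ℓ).val : ℤ))) : ℤ) : ℚ) / ℓ)
      = ratPlusSymbol f ((((V : ZMod ℓ).val : ℚ)) / ℓ) := by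
    rw [show ((((-(((V : ZMod ℓ).val : ℤ))) : ℤ) : ℚ) / ℓ) = -((((V : ZMod ℓ).val : ℚ)) / ℓ) by
      push_cast; ring]
    exact ratPlusSymbol_neg f _
  rw [hneg] at hrat
  push_cast at hrat
  have hw2 : (W.rootNumber : ℚ) ^ 2 = 1 := by exact_mod_cast hσ
  have key : ratPlusSymbol f ((((V : ZMod ℓ).val : ℚ)) / ℓ)
      = (W.rootNumber : ℚ) * ratPlusSymbol f ((((u : ZMod ℓ).val : ℚ)) / ℓ) := by
    rw [hrat, ← mul_assoc, ← sq, hw2, one_mul]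
  exact key

/-- **(R) at the conductor level (`w = +1`)** — unconditional. -/
theorem frickeReflection_conductorLevel (W : WeierstrassCurve ℚ) [W.IsElliptic] [W.IsGloballyMinimal]
    [NeZero (W.conductorNorm ℤ)] {f : CuspForm (Gamma0 (W.conductorNorm ℤ)) 2} (hf : IsNewformOf W f)
    (hw : W.rootNumber = 1) (ℓ : ℕ) [Fact ℓ.Prime] (hN : Nat.Coprime (W.conductorNorm ℤ) ℓ) (u : (ZMod ℓ)ˣ) :
    ratPlusSymbol f (((((ZMod.unitOfCoprime (W.conductorNorm ℤ) hN * u)⁻¹ : (ZMod ℓ)ˣ) : ZMod ℓ).val : ℚ) / ℓ)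
      = ratPlusSymbol f ((((u : ZMod ℓ).val : ℚ)) / ℓ) := by
  have h := frickeReflectionSigned_conductorLevel W hf ℓ hN u
  rw [hw, Int.cast_one, one_mul] at h
  exact h

/-- **(R) at every level, modulo modularity** (`exists_isNewformOf` pins the level to `N_W` through
`IsNewformOf.level_eq_level`). -/
theorem frickeReflectionAtPrimeLevel_of_exists_isNewformOf (hmod : exists_isNewformOf) :
    FrickeReflectionAtPrimeLevel := by
  intro W _ _ M _ f hf hw ℓ _ hN u
  haveI : NeZero (W.conductorNorm ℤ) := ⟨(W.conductorNorm_pos_holds).ne'⟩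
  obtain ⟨g, hg⟩ := hmod W
  have hM : M = W.conductorNorm ℤ := hf.level_eq_level hg
  subst hM
  exact frickeReflection_conductorLevel W hf hw ℓ hN u

/-- **K2-V pointwise**: the vanishing at one `(W, f, ℓ)` from the reflection identity at that `ℓ`;
(H) is supplied by `heckeSumAtPrimeLevel_holds`.  (The v1.4 proof of `levelVanishingAtTwo_of`, verbatim
but for the source of (H).) -/
theorem levelVanishing_pointwise (W : WeierstrassCurve ℚ) [W.IsElliptic] [W.IsGloballyMinimal]
    {M : ℕ} [NeZero M] (f : CuspForm (Gamma0 M) 2) (hf : IsNewformOf W f)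
    (ℓ k : ℕ) [Fact ℓ.Prime] (hN : Nat.Coprime (W.conductorNorm ℤ) ℓ) (hk : 1 ≤ k)
    (hak : (2 ^ k : ℤ) ∣ W.frobeniusTrace ℓ - 2) (h0 : InTwoPowZLoc 0 (ratPlusSymbol f 0))
    (hint : ∀ u : (ZMod ℓ)ˣ, InTwoPowZLoc 0 (2 * ratPlusSymbol f ((((u : ZMod ℓ).val : ℚ)) / ℓ)))
    (hRℓ : ∀ u : (ZMod ℓ)ˣ,
      ratPlusSymbol f (((((ZMod.unitOfCoprime (W.conductorNorm ℤ) hN * u)⁻¹ : (ZMod ℓ)ˣ) : ZMod ℓ).val : ℚ) / ℓ)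
        = ratPlusSymbol f ((((u : ZMod ℓ).val : ℚ)) / ℓ))
    (ψ : (ZMod ℓ)ˣ →* Multiplicative (ZMod (2 ^ k)))
    (hodd : Odd (Multiplicative.toAdd (ψ (ZMod.unitOfCoprime (W.conductorNorm ℤ) hN)⁻¹)).val) :
    InTwoPowZLoc k (levelSumTwo f ℓ k ψ) := by
  haveI : NeZero ℓ := ⟨(Fact.out : ℓ.Prime).ne_zero⟩
  set Nbar : (ZMod ℓ)ˣ := ZMod.unitOfCoprime (W.conductorNorm ℤ) hN with hNbar
  set Λ : (ZMod ℓ)ˣ → ℚ := fun u => 2 * ratPlusSymbol f ((((u : ZMod ℓ).val : ℚ)) / ℓ) with hΛ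
  have hRΛ : ∀ u, Λ (Nbar * u)⁻¹ = Λ u := by
    intro u
    simp only [hΛ, hNbar]
    rw [hRℓ u]
  have hintΛ : ∀ u, Odd (Λ u).den := by
    intro u
    obtain ⟨q, hq, hqd⟩ := hint u
    simp only [hΛ]
    rw [hq, pow_zero, one_mul]
    exact hqd
  have hsumΛ : InTwoPowZLoc (k + 1) (∑ u, Λ u) := by
    obtain ⟨m, hm⟩ := hak
    obtain ⟨q₀, hq₀, hq₀d⟩ := h0
    refine ⟨(m : ℚ) * q₀, ?_, ?_⟩
    · simp only [hΛ]
      rw [← Finset.mul_sum, heckeSumAtPrimeLevel_holds W f hf ℓ hN, hq₀, pow_zero, one_mul]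
      have hm' : ((W.frobeniusTrace ℓ : ℚ) - 2) = (2 : ℚ) ^ k * m := by exact_mod_cast hm
      rw [hm']; ring
    · have h1 : ((m : ℚ) * q₀).den ∣ (m : ℚ).den * q₀.den := Rat.mul_den_dvd _ _
      rw [Rat.den_intCast, one_mul] at h1
      exact hq₀d.of_dvd_nat h1
  have := levelSum_inTwoPowZLoc hk Λ ψ Nbar hRΛ hodd hintΛ hsumΛ
  simpa only [levelSumTwo, hΛ, mul_assoc] using this

/-- **K2-V from (R) alone** ((H) discharged). -/
theorem levelVanishingAtTwo_of (hR : FrickeReflectionAtPrimeLevel) : LevelVanishingAtTwo := by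
  intro W _ _ M _ f hf hw ℓ k _ hN hk hak h0 hint ψ hodd
  exact levelVanishing_pointwise W f hf ℓ k hN hk hak h0 hint (hR W f hf hw ℓ hN) ψ hodd

/-- **K2-V modulo modularity**: `exists_isNewformOf → LevelVanishingAtTwo`. -/
theorem levelVanishingAtTwo_of_exists_isNewformOf (hmod : exists_isNewformOf) : LevelVanishingAtTwo :=
  levelVanishingAtTwo_of (frickeReflectionAtPrimeLevel_of_exists_isNewformOf hmod)

/-- **K2-V at the conductor level — UNCONDITIONAL.**  For `W/ℚ` globally minimal with `w(E) = +1`, `f` its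
newform at level `N_W`, `ℓ ∤ N_W` prime, `k ≥ 1`, `2^k ∣ a_ℓ − 2`, `2`-integral symbols and `ψ` with
`ψ(N̄⁻¹)` odd: `δ'_k(ℓ; ψ) ∈ 2^k ℤ_{(2)}`. -/
theorem levelVanishingAtTwo_conductorLevel (W : WeierstrassCurve ℚ) [W.IsElliptic] [W.IsGloballyMinimal]
    [NeZero (W.conductorNorm ℤ)] (f : CuspForm (Gamma0 (W.conductorNorm ℤ)) 2) (hf : IsNewformOf W f)
    (hw : W.rootNumber = 1) (ℓ k : ℕ) [Fact ℓ.Prime] (hN : Nat.Coprime (W.conductorNorm ℤ) ℓ) (hk : 1 ≤ k)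
    (hak : (2 ^ k : ℤ) ∣ W.frobeniusTrace ℓ - 2) (h0 : InTwoPowZLoc 0 (ratPlusSymbol f 0))
    (hint : ∀ u : (ZMod ℓ)ˣ, InTwoPowZLoc 0 (2 * ratPlusSymbol f ((((u : ZMod ℓ).val : ℚ)) / ℓ)))
    (ψ : (ZMod ℓ)ˣ →* Multiplicative (ZMod (2 ^ k)))
    (hodd : Odd (Multiplicative.toAdd (ψ (ZMod.unitOfCoprime (W.conductorNorm ℤ) hN)⁻¹)).val) :
    InTwoPowZLoc k (levelSumTwo f ℓ k ψ) :=
  levelVanishing_pointwise W f hf ℓ k hN hk hak h0 hint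
    (frickeReflection_conductorLevel W hf hw ℓ hN) ψ hodd

end Discharge

end Summit.BirchSwinnertonDyer.Rank1Residual.F1Sign2
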